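import Summits.Ventures.PackingBounds.ThreePointCert.T19Proof
import Summits.Ventures.PackingBounds.ThreePointCert.T20Proof
import Summits.Ventures.PackingBounds.ThreePointCert.T21Proof
import Summits.Ventures.PackingBounds.ThreePointCert.T22Proof
import Summits.Ventures.PackingBounds.ThreePointCert.T23Proof
import Summits.Ventures.PackingBounds.ThreePointCert.T25Proof
import Summits.Ventures.PackingBounds.ThreePointCert.T26Proof
import Summits.Ventures.PackingBounds.ThreePointCert.T27Proof
import Summits.Ventures.PackingBounds.SphericalCodes.TammesReading
import Summits.Ventures.PackingBounds.Configurations.TammesConfigsA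
import Summits.Ventures.PackingBounds.Configurations.TammesConfigsB
import Summits.Ventures.PackingBounds.Configurations.TammesConfigsC

/-!
# Tammes problem, `N = 19–23, 25–27`: angle readings and two-sided kernel brackets

Framing: lottery ticket; floor = certified bounds/negative ranges. Venture `PackingBounds`
(cell `pub-packcert`), spherical-codes family, table B2b (Tammes) rows `N = 19, 20, 21, 22, 23, 25, 26, 27`.

For each of these `N` the tree holds a kernel-checked Bachoc–Vallentin three-point certificate
`ThreePointCert.T<N>.tammes<N>_card_le_<N-1>_sdp` (`n = 3`, degree 10, Bachoc–Vallentin's multiplier set,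
Chebyshev kernels on `S²`): every finite set of unit vectors of `ℝ³` with pairwise inner products `≤ s_N`
has at most `N - 1` elements, for the rational `s_N` listed below.  This file only READS those theorems in
Tammes form (pattern of `TammesEighteen.lean`): among any `N` or more points of `S²` two distinct ones make an
angle `< arccos s_N`, so `θ(N) < arccos s_N`; and it pairs each reading with the explicitly constructed
`N`-point configuration of `Config.TammesConfigsA/B/C` (`Config.Tammes.exists_code_N`, the best configuration
known) into ONE kernel statement `⌊config angle⌋ ≤ θ(N) < arccos s_N`.

| `N` | `s_N` | `arccos s_N` | configuration inner product `≤` | configuration angle |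
|---|---|---|---|---|
| 19 | `1307/2000` | `49.1940…°` | `67311693/10⁸` | `47.6919…°` |
| 20 | `167/250` | `48.0871…°` | `67647719/10⁸` | `47.4310…°` |
| 21 | `1369/2000` | `46.8037…°` | `69949848/10⁸` | `45.6132…°` |
| 22 | `699/1000` | `45.6532…°` | `71030632/10⁸` | `44.7402…°` |
| 23 | `7103/10000` | `44.7407…°` | `72284705/10⁸` | `43.7100…°` |
| 25 | `727/1000` | `43.3645…°` | `74739868/10⁸` | `41.6345…°` |
| 26 | `7373/10000` | `42.4981…°` | `75427824/10⁸` | `41.0377…°` |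
| 27 | `1867/2500` | `41.6861…°` | `75838926/10⁸` | `40.6776…°` |

A certified bound per row, not a configuration and not an optimality claim; print comparison (classical
Fejes Tóth 1943 bounds, no semidefinite bound printed for these `N`) is carried by the cell's table, not here.

## References
* C. Bachoc, F. Vallentin, New upper bounds for kissing numbers from semidefinite programming,
  J. Amer. Math. Soc. 21 (2008), Theorem 4.2. [`BachocVallentin2007`]
-/

noncomputable section

open Finset
open scoped RealInnerProductSpace

namespace Summit.Ventures.PackingBounds.SphericalCodes

/-- **Tammes `N = 19`, inner products**: among any `19` or more unit vectors of `ℝ³`, two distinct ones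
have inner product `> 1307/2000`. -/
theorem tammes19_exists_inner_gt (C : Finset (EuclideanSpace ℝ (Fin 3)))
    (h1 : ∀ x ∈ C, ‖x‖ = 1) (hC : 18 < C.card) :
    ∃ x ∈ C, ∃ y ∈ C, x ≠ y ∧ (1307 / 2000 : ℝ) < inner ℝ x y :=
  exists_inner_gt_of_codeBound ThreePointCert.T19.tammes19_card_le_18_sdp C h1 hC

/-- **Tammes `N = 19`, angles**: among any `19` or more unit vectors of `ℝ³`, two distinct ones make an
(unoriented) angle `< arccos(1307/2000)` (`= 49.1940…°`; classical Fejes Tóth (1943) bound `50.30°`). -/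
theorem tammes19_exists_angle_lt_arccos (C : Finset (EuclideanSpace ℝ (Fin 3)))
    (h1 : ∀ x ∈ C, ‖x‖ = 1) (hC : 18 < C.card) :
    ∃ x ∈ C, ∃ y ∈ C, x ≠ y ∧ InnerProductGeometry.angle x y < Real.arccos (1307 / 2000) :=
  exists_angle_lt_arccos_of_codeBound ThreePointCert.T19.tammes19_card_le_18_sdp
    (by norm_num) C h1 hC

/-- **`θ(19) < arccos(1307/2000)`**: any common lower bound `θ` for the pairwise angles of `19` or more
unit vectors of `ℝ³` satisfies `θ < arccos(1307/2000)`. -/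
theorem tammes19_minAngle_lt_arccos (C : Finset (EuclideanSpace ℝ (Fin 3)))
    (h1 : ∀ x ∈ C, ‖x‖ = 1) (hC : 18 < C.card) (θ : ℝ)
    (hθ : ∀ x ∈ C, ∀ y ∈ C, x ≠ y → θ ≤ InnerProductGeometry.angle x y) :
    θ < Real.arccos (1307 / 2000) :=
  minAngle_lt_arccos_of_codeBound ThreePointCert.T19.tammes19_card_le_18_sdp
    (by norm_num) C h1 hC θ hθ

/-- **Kernel bracket for the 19-point Tammes problem** (both sides in the tree): there ARE 19 unit vectors of
`ℝ³` with all pairwise inner products `≤ 67311693/10⁸` (`Config.Tammes.exists_code_19`, the best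
configuration known, angle `47.6919…°`), and among ANY 19 unit vectors two distinct ones have inner product
`> 1307/2000` (angle `< 49.1940…°`). In Tammes terms: `47.6919…° ≤ θ(19) < 49.1940…°`. -/
theorem tammes19_bracket :
    (∃ C : Finset (EuclideanSpace ℝ (Fin 3)), C.card = 19 ∧ (∀ x ∈ C, ‖x‖ = 1) ∧
      ∀ x ∈ C, ∀ y ∈ C, x ≠ y → inner ℝ x y ≤ (67311693 : ℝ) / 100000000) ∧
    ∀ C : Finset (EuclideanSpace ℝ (Fin 3)), (∀ x ∈ C, ‖x‖ = 1) → 18 < C.card →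
      ∃ x ∈ C, ∃ y ∈ C, x ≠ y ∧ (1307 / 2000 : ℝ) < inner ℝ x y :=
  ⟨Config.Tammes.exists_code_19, fun C h1 hC => tammes19_exists_inner_gt C h1 hC⟩

/-- **Tammes `N = 20`, inner products**: among any `20` or more unit vectors of `ℝ³`, two distinct ones
have inner product `> 167/250`. -/
theorem tammes20_exists_inner_gt (C : Finset (EuclideanSpace ℝ (Fin 3)))
    (h1 : ∀ x ∈ C, ‖x‖ = 1) (hC : 19 < C.card) :
    ∃ x ∈ C, ∃ y ∈ C, x ≠ y ∧ (167 / 250 : ℝ) < inner ℝ x y :=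
  exists_inner_gt_of_codeBound ThreePointCert.T20.tammes20_card_le_19_sdp C h1 hC

/-- **Tammes `N = 20`, angles**: among any `20` or more unit vectors of `ℝ³`, two distinct ones make an
(unoriented) angle `< arccos(167/250)` (`= 48.0871…°`; classical Fejes Tóth bound `49.02°`). -/
theorem tammes20_exists_angle_lt_arccos (C : Finset (EuclideanSpace ℝ (Fin 3)))
    (h1 : ∀ x ∈ C, ‖x‖ = 1) (hC : 19 < C.card) :
    ∃ x ∈ C, ∃ y ∈ C, x ≠ y ∧ InnerProductGeometry.angle x y < Real.arccos (167 / 250) :=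
  exists_angle_lt_arccos_of_codeBound ThreePointCert.T20.tammes20_card_le_19_sdp
    (by norm_num) C h1 hC

/-- **`θ(20) < arccos(167/250)`**: any common lower bound `θ` for the pairwise angles of `20` or more
unit vectors of `ℝ³` satisfies `θ < arccos(167/250)`. -/
theorem tammes20_minAngle_lt_arccos (C : Finset (EuclideanSpace ℝ (Fin 3)))
    (h1 : ∀ x ∈ C, ‖x‖ = 1) (hC : 19 < C.card) (θ : ℝ)
    (hθ : ∀ x ∈ C, ∀ y ∈ C, x ≠ y → θ ≤ InnerProductGeometry.angle x y) :
    θ < Real.arccos (167 / 250) :=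
  minAngle_lt_arccos_of_codeBound ThreePointCert.T20.tammes20_card_le_19_sdp
    (by norm_num) C h1 hC θ hθ

/-- **Kernel bracket for the 20-point Tammes problem** (both sides in the tree): there ARE 20 unit vectors of
`ℝ³` with all pairwise inner products `≤ 67647719/10⁸` (`Config.Tammes.exists_code_20`, the best
configuration known, angle `47.4310…°`), and among ANY 20 unit vectors two distinct ones have inner product
`> 167/250` (angle `< 48.0871…°`). In Tammes terms: `47.4310…° ≤ θ(20) < 48.0871…°`. -/
theorem tammes20_bracket :
    (∃ C : Finset (EuclideanSpace ℝ (Fin 3)), C.card = 20 ∧ (∀ x ∈ C, ‖x‖ = 1) ∧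
      ∀ x ∈ C, ∀ y ∈ C, x ≠ y → inner ℝ x y ≤ (67647719 : ℝ) / 100000000) ∧
    ∀ C : Finset (EuclideanSpace ℝ (Fin 3)), (∀ x ∈ C, ‖x‖ = 1) → 19 < C.card →
      ∃ x ∈ C, ∃ y ∈ C, x ≠ y ∧ (167 / 250 : ℝ) < inner ℝ x y :=
  ⟨Config.Tammes.exists_code_20, fun C h1 hC => tammes20_exists_inner_gt C h1 hC⟩

/-- **Tammes `N = 21`, inner products**: among any `21` or more unit vectors of `ℝ³`, two distinct ones
have inner product `> 1369/2000`. -/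
theorem tammes21_exists_inner_gt (C : Finset (EuclideanSpace ℝ (Fin 3)))
    (h1 : ∀ x ∈ C, ‖x‖ = 1) (hC : 20 < C.card) :
    ∃ x ∈ C, ∃ y ∈ C, x ≠ y ∧ (1369 / 2000 : ℝ) < inner ℝ x y :=
  exists_inner_gt_of_codeBound ThreePointCert.T21.tammes21_card_le_20_sdp C h1 hC

/-- **Tammes `N = 21`, angles**: among any `21` or more unit vectors of `ℝ³`, two distinct ones make an
(unoriented) angle `< arccos(1369/2000)` (`= 46.8037…°`; classical Fejes Tóth bound `47.83°`). -/
theorem tammes21_exists_angle_lt_arccos (C : Finset (EuclideanSpace ℝ (Fin 3)))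
    (h1 : ∀ x ∈ C, ‖x‖ = 1) (hC : 20 < C.card) :
    ∃ x ∈ C, ∃ y ∈ C, x ≠ y ∧ InnerProductGeometry.angle x y < Real.arccos (1369 / 2000) :=
  exists_angle_lt_arccos_of_codeBound ThreePointCert.T21.tammes21_card_le_20_sdp
    (by norm_num) C h1 hC

/-- **`θ(21) < arccos(1369/2000)`**: any common lower bound `θ` for the pairwise angles of `21` or more
unit vectors of `ℝ³` satisfies `θ < arccos(1369/2000)`. -/
theorem tammes21_minAngle_lt_arccos (C : Finset (EuclideanSpace ℝ (Fin 3)))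
    (h1 : ∀ x ∈ C, ‖x‖ = 1) (hC : 20 < C.card) (θ : ℝ)
    (hθ : ∀ x ∈ C, ∀ y ∈ C, x ≠ y → θ ≤ InnerProductGeometry.angle x y) :
    θ < Real.arccos (1369 / 2000) :=
  minAngle_lt_arccos_of_codeBound ThreePointCert.T21.tammes21_card_le_20_sdp
    (by norm_num) C h1 hC θ hθ

/-- **Kernel bracket for the 21-point Tammes problem** (both sides in the tree): there ARE 21 unit vectors of
`ℝ³` with all pairwise inner products `≤ 69949848/10⁸` (`Config.Tammes.exists_code_21`, the best
configuration known, angle `45.6132…°`), and among ANY 21 unit vectors two distinct ones have inner product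
`> 1369/2000` (angle `< 46.8037…°`). In Tammes terms: `45.6132…° ≤ θ(21) < 46.8037…°`. -/
theorem tammes21_bracket :
    (∃ C : Finset (EuclideanSpace ℝ (Fin 3)), C.card = 21 ∧ (∀ x ∈ C, ‖x‖ = 1) ∧
      ∀ x ∈ C, ∀ y ∈ C, x ≠ y → inner ℝ x y ≤ (69949848 : ℝ) / 100000000) ∧
    ∀ C : Finset (EuclideanSpace ℝ (Fin 3)), (∀ x ∈ C, ‖x‖ = 1) → 20 < C.card →
      ∃ x ∈ C, ∃ y ∈ C, x ≠ y ∧ (1369 / 2000 : ℝ) < inner ℝ x y :=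
  ⟨Config.Tammes.exists_code_21, fun C h1 hC => tammes21_exists_inner_gt C h1 hC⟩

/-- **Tammes `N = 22`, inner products**: among any `22` or more unit vectors of `ℝ³`, two distinct ones
have inner product `> 699/1000`. -/
theorem tammes22_exists_inner_gt (C : Finset (EuclideanSpace ℝ (Fin 3)))
    (h1 : ∀ x ∈ C, ‖x‖ = 1) (hC : 21 < C.card) :
    ∃ x ∈ C, ∃ y ∈ C, x ≠ y ∧ (699 / 1000 : ℝ) < inner ℝ x y :=
  exists_inner_gt_of_codeBound ThreePointCert.T22.tammes22_card_le_21_sdp C h1 hC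

/-- **Tammes `N = 22`, angles**: among any `22` or more unit vectors of `ℝ³`, two distinct ones make an
(unoriented) angle `< arccos(699/1000)` (`= 45.6532…°`; classical Fejes Tóth bound `46.72°`). -/
theorem tammes22_exists_angle_lt_arccos (C : Finset (EuclideanSpace ℝ (Fin 3)))
    (h1 : ∀ x ∈ C, ‖x‖ = 1) (hC : 21 < C.card) :
    ∃ x ∈ C, ∃ y ∈ C, x ≠ y ∧ InnerProductGeometry.angle x y < Real.arccos (699 / 1000) :=
  exists_angle_lt_arccos_of_codeBound ThreePointCert.T22.tammes22_card_le_21_sdp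
    (by norm_num) C h1 hC

/-- **`θ(22) < arccos(699/1000)`**: any common lower bound `θ` for the pairwise angles of `22` or more
unit vectors of `ℝ³` satisfies `θ < arccos(699/1000)`. -/
theorem tammes22_minAngle_lt_arccos (C : Finset (EuclideanSpace ℝ (Fin 3)))
    (h1 : ∀ x ∈ C, ‖x‖ = 1) (hC : 21 < C.card) (θ : ℝ)
    (hθ : ∀ x ∈ C, ∀ y ∈ C, x ≠ y → θ ≤ InnerProductGeometry.angle x y) :
    θ < Real.arccos (699 / 1000) :=
  minAngle_lt_arccos_of_codeBound ThreePointCert.T22.tammes22_card_le_21_sdp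
    (by norm_num) C h1 hC θ hθ

/-- **Kernel bracket for the 22-point Tammes problem** (both sides in the tree): there ARE 22 unit vectors of
`ℝ³` with all pairwise inner products `≤ 71030632/10⁸` (`Config.Tammes.exists_code_22`, the best
configuration known, angle `44.7402…°`), and among ANY 22 unit vectors two distinct ones have inner product
`> 699/1000` (angle `< 45.6532…°`). In Tammes terms: `44.7402…° ≤ θ(22) < 45.6532…°`. -/
theorem tammes22_bracket :
    (∃ C : Finset (EuclideanSpace ℝ (Fin 3)), C.card = 22 ∧ (∀ x ∈ C, ‖x‖ = 1) ∧
      ∀ x ∈ C, ∀ y ∈ C, x ≠ y → inner ℝ x y ≤ (71030632 : ℝ) / 100000000) ∧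
    ∀ C : Finset (EuclideanSpace ℝ (Fin 3)), (∀ x ∈ C, ‖x‖ = 1) → 21 < C.card →
      ∃ x ∈ C, ∃ y ∈ C, x ≠ y ∧ (699 / 1000 : ℝ) < inner ℝ x y :=
  ⟨Config.Tammes.exists_code_22, fun C h1 hC => tammes22_exists_inner_gt C h1 hC⟩

/-- **Tammes `N = 23`, inner products**: among any `23` or more unit vectors of `ℝ³`, two distinct ones
have inner product `> 7103/10000`. -/
theorem tammes23_exists_inner_gt (C : Finset (EuclideanSpace ℝ (Fin 3)))
    (h1 : ∀ x ∈ C, ‖x‖ = 1) (hC : 22 < C.card) :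
    ∃ x ∈ C, ∃ y ∈ C, x ≠ y ∧ (7103 / 10000 : ℝ) < inner ℝ x y :=
  exists_inner_gt_of_codeBound ThreePointCert.T23.tammes23_card_le_22_sdp C h1 hC

/-- **Tammes `N = 23`, angles**: among any `23` or more unit vectors of `ℝ³`, two distinct ones make an
(unoriented) angle `< arccos(7103/10000)` (`= 44.7407…°`; classical Fejes Tóth bound `45.68°`). -/
theorem tammes23_exists_angle_lt_arccos (C : Finset (EuclideanSpace ℝ (Fin 3)))
    (h1 : ∀ x ∈ C, ‖x‖ = 1) (hC : 22 < C.card) :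
    ∃ x ∈ C, ∃ y ∈ C, x ≠ y ∧ InnerProductGeometry.angle x y < Real.arccos (7103 / 10000) :=
  exists_angle_lt_arccos_of_codeBound ThreePointCert.T23.tammes23_card_le_22_sdp
    (by norm_num) C h1 hC

/-- **`θ(23) < arccos(7103/10000)`**: any common lower bound `θ` for the pairwise angles of `23` or more
unit vectors of `ℝ³` satisfies `θ < arccos(7103/10000)`. -/
theorem tammes23_minAngle_lt_arccos (C : Finset (EuclideanSpace ℝ (Fin 3)))
    (h1 : ∀ x ∈ C, ‖x‖ = 1) (hC : 22 < C.card) (θ : ℝ)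
    (hθ : ∀ x ∈ C, ∀ y ∈ C, x ≠ y → θ ≤ InnerProductGeometry.angle x y) :
    θ < Real.arccos (7103 / 10000) :=
  minAngle_lt_arccos_of_codeBound ThreePointCert.T23.tammes23_card_le_22_sdp
    (by norm_num) C h1 hC θ hθ

/-- **Kernel bracket for the 23-point Tammes problem** (both sides in the tree): there ARE 23 unit vectors of
`ℝ³` with all pairwise inner products `≤ 72284705/10⁸` (`Config.Tammes.exists_code_23`, the best
configuration known, angle `43.7100…°`), and among ANY 23 unit vectors two distinct ones have inner product
`> 7103/10000` (angle `< 44.7407…°`). In Tammes terms: `43.7100…° ≤ θ(23) < 44.7407…°`. -/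
theorem tammes23_bracket :
    (∃ C : Finset (EuclideanSpace ℝ (Fin 3)), C.card = 23 ∧ (∀ x ∈ C, ‖x‖ = 1) ∧
      ∀ x ∈ C, ∀ y ∈ C, x ≠ y → inner ℝ x y ≤ (72284705 : ℝ) / 100000000) ∧
    ∀ C : Finset (EuclideanSpace ℝ (Fin 3)), (∀ x ∈ C, ‖x‖ = 1) → 22 < C.card →
      ∃ x ∈ C, ∃ y ∈ C, x ≠ y ∧ (7103 / 10000 : ℝ) < inner ℝ x y :=
  ⟨Config.Tammes.exists_code_23, fun C h1 hC => tammes23_exists_inner_gt C h1 hC⟩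

/-- **Tammes `N = 25`, inner products**: among any `25` or more unit vectors of `ℝ³`, two distinct ones
have inner product `> 727/1000`. -/
theorem tammes25_exists_inner_gt (C : Finset (EuclideanSpace ℝ (Fin 3)))
    (h1 : ∀ x ∈ C, ‖x‖ = 1) (hC : 24 < C.card) :
    ∃ x ∈ C, ∃ y ∈ C, x ≠ y ∧ (727 / 1000 : ℝ) < inner ℝ x y :=
  exists_inner_gt_of_codeBound ThreePointCert.T25.tammes25_card_le_24_sdp C h1 hC

/-- **Tammes `N = 25`, angles**: among any `25` or more unit vectors of `ℝ³`, two distinct ones make an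
(unoriented) angle `< arccos(727/1000)` (`= 43.3645…°`; classical Fejes Tóth bound). -/
theorem tammes25_exists_angle_lt_arccos (C : Finset (EuclideanSpace ℝ (Fin 3)))
    (h1 : ∀ x ∈ C, ‖x‖ = 1) (hC : 24 < C.card) :
    ∃ x ∈ C, ∃ y ∈ C, x ≠ y ∧ InnerProductGeometry.angle x y < Real.arccos (727 / 1000) :=
  exists_angle_lt_arccos_of_codeBound ThreePointCert.T25.tammes25_card_le_24_sdp
    (by norm_num) C h1 hC

/-- **`θ(25) < arccos(727/1000)`**: any common lower bound `θ` for the pairwise angles of `25` or more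
unit vectors of `ℝ³` satisfies `θ < arccos(727/1000)`. -/
theorem tammes25_minAngle_lt_arccos (C : Finset (EuclideanSpace ℝ (Fin 3)))
    (h1 : ∀ x ∈ C, ‖x‖ = 1) (hC : 24 < C.card) (θ : ℝ)
    (hθ : ∀ x ∈ C, ∀ y ∈ C, x ≠ y → θ ≤ InnerProductGeometry.angle x y) :
    θ < Real.arccos (727 / 1000) :=
  minAngle_lt_arccos_of_codeBound ThreePointCert.T25.tammes25_card_le_24_sdp
    (by norm_num) C h1 hC θ hθ

/-- **Kernel bracket for the 25-point Tammes problem** (both sides in the tree): there ARE 25 unit vectors of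
`ℝ³` with all pairwise inner products `≤ 74739868/10⁸` (`Config.Tammes.exists_code_25`, the best
configuration known, angle `41.6345…°`), and among ANY 25 unit vectors two distinct ones have inner product
`> 727/1000` (angle `< 43.3645…°`). In Tammes terms: `41.6345…° ≤ θ(25) < 43.3645…°`. -/
theorem tammes25_bracket :
    (∃ C : Finset (EuclideanSpace ℝ (Fin 3)), C.card = 25 ∧ (∀ x ∈ C, ‖x‖ = 1) ∧
      ∀ x ∈ C, ∀ y ∈ C, x ≠ y → inner ℝ x y ≤ (74739868 : ℝ) / 100000000) ∧
    ∀ C : Finset (EuclideanSpace ℝ (Fin 3)), (∀ x ∈ C, ‖x‖ = 1) → 24 < C.card →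
      ∃ x ∈ C, ∃ y ∈ C, x ≠ y ∧ (727 / 1000 : ℝ) < inner ℝ x y :=
  ⟨Config.Tammes.exists_code_25, fun C h1 hC => tammes25_exists_inner_gt C h1 hC⟩

/-- **Tammes `N = 26`, inner products**: among any `26` or more unit vectors of `ℝ³`, two distinct ones
have inner product `> 7373/10000`. -/
theorem tammes26_exists_inner_gt (C : Finset (EuclideanSpace ℝ (Fin 3)))
    (h1 : ∀ x ∈ C, ‖x‖ = 1) (hC : 25 < C.card) :
    ∃ x ∈ C, ∃ y ∈ C, x ≠ y ∧ (7373 / 10000 : ℝ) < inner ℝ x y :=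
  exists_inner_gt_of_codeBound ThreePointCert.T26.tammes26_card_le_25_sdp C h1 hC

/-- **Tammes `N = 26`, angles**: among any `26` or more unit vectors of `ℝ³`, two distinct ones make an
(unoriented) angle `< arccos(7373/10000)` (`= 42.4981…°`; classical Fejes Tóth bound). -/
theorem tammes26_exists_angle_lt_arccos (C : Finset (EuclideanSpace ℝ (Fin 3)))
    (h1 : ∀ x ∈ C, ‖x‖ = 1) (hC : 25 < C.card) :
    ∃ x ∈ C, ∃ y ∈ C, x ≠ y ∧ InnerProductGeometry.angle x y < Real.arccos (7373 / 10000) :=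
  exists_angle_lt_arccos_of_codeBound ThreePointCert.T26.tammes26_card_le_25_sdp
    (by norm_num) C h1 hC

/-- **`θ(26) < arccos(7373/10000)`**: any common lower bound `θ` for the pairwise angles of `26` or more
unit vectors of `ℝ³` satisfies `θ < arccos(7373/10000)`. -/
theorem tammes26_minAngle_lt_arccos (C : Finset (EuclideanSpace ℝ (Fin 3)))
    (h1 : ∀ x ∈ C, ‖x‖ = 1) (hC : 25 < C.card) (θ : ℝ)
    (hθ : ∀ x ∈ C, ∀ y ∈ C, x ≠ y → θ ≤ InnerProductGeometry.angle x y) :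
    θ < Real.arccos (7373 / 10000) :=
  minAngle_lt_arccos_of_codeBound ThreePointCert.T26.tammes26_card_le_25_sdp
    (by norm_num) C h1 hC θ hθ

/-- **Kernel bracket for the 26-point Tammes problem** (both sides in the tree): there ARE 26 unit vectors of
`ℝ³` with all pairwise inner products `≤ 75427824/10⁸` (`Config.Tammes.exists_code_26`, the best
configuration known, angle `41.0377…°`), and among ANY 26 unit vectors two distinct ones have inner product
`> 7373/10000` (angle `< 42.4981…°`). In Tammes terms: `41.0377…° ≤ θ(26) < 42.4981…°`. -/
theorem tammes26_bracket :
    (∃ C : Finset (EuclideanSpace ℝ (Fin 3)), C.card = 26 ∧ (∀ x ∈ C, ‖x‖ = 1) ∧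
      ∀ x ∈ C, ∀ y ∈ C, x ≠ y → inner ℝ x y ≤ (75427824 : ℝ) / 100000000) ∧
    ∀ C : Finset (EuclideanSpace ℝ (Fin 3)), (∀ x ∈ C, ‖x‖ = 1) → 25 < C.card →
      ∃ x ∈ C, ∃ y ∈ C, x ≠ y ∧ (7373 / 10000 : ℝ) < inner ℝ x y :=
  ⟨Config.Tammes.exists_code_26, fun C h1 hC => tammes26_exists_inner_gt C h1 hC⟩

/-- **Tammes `N = 27`, inner products**: among any `27` or more unit vectors of `ℝ³`, two distinct ones
have inner product `> 1867/2500`. -/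
theorem tammes27_exists_inner_gt (C : Finset (EuclideanSpace ℝ (Fin 3)))
    (h1 : ∀ x ∈ C, ‖x‖ = 1) (hC : 26 < C.card) :
    ∃ x ∈ C, ∃ y ∈ C, x ≠ y ∧ (1867 / 2500 : ℝ) < inner ℝ x y :=
  exists_inner_gt_of_codeBound ThreePointCert.T27.tammes27_card_le_26_sdp C h1 hC

/-- **Tammes `N = 27`, angles**: among any `27` or more unit vectors of `ℝ³`, two distinct ones make an
(unoriented) angle `< arccos(1867/2500)` (`= 41.6861…°`; classical Fejes Tóth bound). -/
theorem tammes27_exists_angle_lt_arccos (C : Finset (EuclideanSpace ℝ (Fin 3)))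
    (h1 : ∀ x ∈ C, ‖x‖ = 1) (hC : 26 < C.card) :
    ∃ x ∈ C, ∃ y ∈ C, x ≠ y ∧ InnerProductGeometry.angle x y < Real.arccos (1867 / 2500) :=
  exists_angle_lt_arccos_of_codeBound ThreePointCert.T27.tammes27_card_le_26_sdp
    (by norm_num) C h1 hC

/-- **`θ(27) < arccos(1867/2500)`**: any common lower bound `θ` for the pairwise angles of `27` or more
unit vectors of `ℝ³` satisfies `θ < arccos(1867/2500)`. -/
theorem tammes27_minAngle_lt_arccos (C : Finset (EuclideanSpace ℝ (Fin 3)))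
    (h1 : ∀ x ∈ C, ‖x‖ = 1) (hC : 26 < C.card) (θ : ℝ)
    (hθ : ∀ x ∈ C, ∀ y ∈ C, x ≠ y → θ ≤ InnerProductGeometry.angle x y) :
    θ < Real.arccos (1867 / 2500) :=
  minAngle_lt_arccos_of_codeBound ThreePointCert.T27.tammes27_card_le_26_sdp
    (by norm_num) C h1 hC θ hθ

/-- **Kernel bracket for the 27-point Tammes problem** (both sides in the tree): there ARE 27 unit vectors of
`ℝ³` with all pairwise inner products `≤ 75838926/10⁸` (`Config.Tammes.exists_code_27`, the best
configuration known, angle `40.6776…°`), and among ANY 27 unit vectors two distinct ones have inner product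
`> 1867/2500` (angle `< 41.6861…°`). In Tammes terms: `40.6776…° ≤ θ(27) < 41.6861…°`. -/
theorem tammes27_bracket :
    (∃ C : Finset (EuclideanSpace ℝ (Fin 3)), C.card = 27 ∧ (∀ x ∈ C, ‖x‖ = 1) ∧
      ∀ x ∈ C, ∀ y ∈ C, x ≠ y → inner ℝ x y ≤ (75838926 : ℝ) / 100000000) ∧
    ∀ C : Finset (EuclideanSpace ℝ (Fin 3)), (∀ x ∈ C, ‖x‖ = 1) → 26 < C.card →
      ∃ x ∈ C, ∃ y ∈ C, x ≠ y ∧ (1867 / 2500 : ℝ) < inner ℝ x y :=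
  ⟨Config.Tammes.exists_code_27, fun C h1 hC => tammes27_exists_inner_gt C h1 hC⟩

end Summit.Ventures.PackingBounds.SphericalCodes

end
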